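import Literature.Topology.FourManifolds.CircleDiffeotopyProofs
import Literature.Topology.FourManifolds.InfiniteCyclicCover
import Literature.AlgebraicTopology.Homotopy.FibreBundlesProofs
import Literature.AlgebraicTopology.Homotopy.FibreBundlesWeakEquivalence
import HarnessLib

/-!
# A closed manifold that submerses onto the circle fibres over it with connected fibres

General differential topology ("Stein factorisation" of a circle-valued submersion). Let `P` be
a compact connected `C^∞` manifold (Hausdorff, second countable, modelled on `ℝⁿ`) and
`f : P → 𝕊¹` a `C^∞` submersion (`mfderiv f x` onto for every `x`). Then there are an integer
`d ≥ 1` and a `C^∞` submersion `g : P → 𝕊¹` with `g(x)ᵈ = f(x)` (as unit complex numbers) all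
of whose fibres `g⁻¹(θ)` are (path) connected
(`exists_contMDiff_surjective_mfderiv_isPathConnected_fibre`). In particular the existence of a
smooth submersion `P → 𝕊¹` already gives one with connected fibres — which is how the conclusion
"`M` fibres over a circle with connected fibres" of fibration theorems over `b₁`-tori is usually
normalised (e.g. Huang–Huang–Wang–Zhu 2026, Main Theorem 1, see
`Literature/Geometry/Riemannian/AlmostNonnegRicciFibration.lean`; there the connectedness is
obtained metrically, here topologically).

## The proof (classical covering-space and fibre-bundle theory)

Write `F = f` read in `Circle ⊆ ℂ` and use the tree's angle increments
`CircleMaps.incr F γ ∈ ℝ` of `F` along paths `γ` and winding numbers `CircleMaps.winding F γ ∈ ℤ`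
along loops (`Literature/Topology/FourManifolds/CircleMapWinding.lean`, Hatcher 2002, §1.1 and
Prop. 1.30).

1. *The period group.* The winding numbers of `F` along loops at `x₀` form a subgroup `dℤ` of
   `ℤ`, `d ≥ 0` (`exists_nat_generator_winding`).
2. *The `d`-th root* (the construction in the proof of the lifting criterion, Hatcher 2002,
   Prop. 1.33: "`f̃(y) = f̃γ(1)`", applied to the `d`-fold cover of the circle): for `r ∈ ℝ` put
   `g_r(x) = (cos, sin)(r · (arg F(x₀) + incr F γₓ))` for some path `γₓ` from `x₀` to `x`
   (`rootMap`). If `r · incr F γ ∈ 2πℤ` for all loops `γ` at `x₀` (e.g. `r = 1/d`), the value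
   does not depend on `γₓ` (`rootMap_eq_of_path`), and near every point
   `g_r = (cos, sin) ∘ (c + r · L ∘ f)` for a smooth local angle `L` of the circle
   (`exists_nhds_rootMap_eq`; the tree's `angA`, `angB`); hence `g_r` is `C^∞` when `f` is
   (`contMDiff_rootMap`) and, for `r ≠ 0`, `dg_r` is onto exactly where `df` is
   (`surjective_mfderiv_rootMap_iff`: `d(cos, sin)` is injective and `T𝕊¹` is a line).
3. *`d ≠ 0`* (`exists_winding_ne_zero`): if all winding numbers vanished, `g_1` would come with
   a continuous — hence smooth — real lift `Λ` of `f` on the compact `P`; at a maximum point of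
   `Λ`, `dΛ = 0` (Fermat), so `df = d(cos, sin) ∘ dΛ` is not onto.
4. For `r = 1/d`: `g(x)ᵈ = F(x)` (`toCircle_rootMap_pow`), so `winding F = d · winding g`
   (the tree's `CircleMaps.winding_zpow`) and some loop has `g`-winding number `1`.
5. *Connected fibres* (the segment `π₁(P) → π₁(𝕊¹) → π₀(g⁻¹θ) → π₀(P) = 0` of the homotopy
   sequence, Hatcher 2002, Thm. 4.41 with Prop. 4.48, made explicit): `g` is a proper submersion,
   hence a locally trivial fibration (Ehresmann, Bröcker–Jänich (8.12), the tree's PROVED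
   `ehresmann_fibration_holds`), hence a fibre bundle with a fixed fibre over the connected base
   (`isFibreBundleWith_of_isLocallyTrivialFibration`). Given `a`, `b` in one fibre, correct a path
   `α` from `a` to `b` by a power of a loop of winding number `1` to get a path `β` with
   `incr g β = 0`; then `g ∘ β` lifts to a LOOP in `ℝ`, so it is null-homotopic rel endpoints, and
   the relative homotopy lifting property of the bundle (the tree's
   `IsFibreBundleWith.exists_homotopy_lift_rel`) deforms `β`, endpoints sliding inside the fibre,
   to a path inside the fibre (`joinedIn_fibre_of_winding_eq_one`).

Everything here is proved; no named fact (`def … : Prop`) is introduced. The new definitions are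
the constructions of the proof (`toCircleC`, `circleLift`, `rootMap`, `loopPow`).

## References

* A. Hatcher, *Algebraic Topology*, CUP (2002), §1.1 Thm. 1.7, §1.3 Props. 1.30, 1.33 (held copy
  `book:hatchernd-algebraic-topology`, PDF pp. 82, 84), §4.2 Thm. 4.41 and Prop. 4.48 (PDF
  pp. 488, 493). [HatcherAT2002]
* Th. Bröcker, K. Jänich, *Introduction to Differential Topology*, CUP (1982), (8.12) (Ehresmann).
  [BrockerJanichIDT1982]
* H. Huang, X.-T. Huang, J. Wang, X. Zhu, arXiv:2605.24380 (2026), Main Theorem 1 and its proof,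
  p. 14 (the application). [HuangHuangWangZhu2026]
-/

noncomputable section

open scoped Manifold ContDiff Topology Real
open Function Set Filter

namespace Literature.Geometry.Manifold

open Literature.Topology.FourManifolds Literature.Topology.FourManifolds.CircleMaps
  Literature.AlgebraicTopology.Homotopy

/-- Local notation: the unit circle in `EuclideanSpace ℝ (Fin 2)` (the tree's `𝕊 1`). -/
local notation "𝕊¹" => (Metric.sphere (0 : EuclideanSpace ℝ (Fin 2)) 1)

universe u

/-! ### The circle: `toCircle`, `circlePoint`, smooth local angles -/

section CircleFacts

/-- `toCircle (cos s, sin s) = e^{is}`. [folklore] -/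
theorem toCircle_circlePoint (s : ℝ) : toCircle (circlePoint s) = Circle.exp s := by
  have h : circlePoint s = circlePt (s / (2 * π)) := by
    rw [circlePt_eq_circlePoint]
    congr 1
    field_simp
  rw [h, toCircle_circlePt]
  congr 1
  field_simp

/-- `toCircle : 𝕊¹ → Circle` is continuous. [folklore] -/
theorem continuous_toCircle_sphereOne : Continuous (toCircle : 𝕊¹ → Circle) :=
  (contDiff_toC.continuous.comp continuous_subtype_val).subtype_mk _

/-- `toCircle` as a bundled continuous map `𝕊¹ → Circle`. [folklore] -/
def toCircleC : C(𝕊¹, Circle) := ⟨toCircle, continuous_toCircle_sphereOne⟩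

/-- `toCircleC` is `toCircle`. [folklore] -/
@[simp] theorem toCircleC_apply (u : 𝕊¹) : toCircleC u = toCircle u := rfl

/-- If `e^{is} = toCircle u` then `(cos s, sin s) = u`. [folklore] -/
theorem circlePoint_eq_of_exp_eq {s : ℝ} {u : 𝕊¹} (h : Circle.exp s = toCircle u) :
    circlePoint s = u :=
  toCircle_injective (by rw [toCircle_circlePoint, h])

/-- **Smooth local angles.** Every point of the circle has an open neighbourhood `V` and a
global right inverse `L` of `circlePoint` (`circlePoint (L u) = u` for ALL `u`) which is `C^∞` on
`V` (one of `2π · angA`, `2π · angB` of the tree). [folklore] -/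
theorem exists_isOpen_angle (u₀ : 𝕊¹) : ∃ V : Set 𝕊¹, IsOpen V ∧ u₀ ∈ V ∧ ∃ L : 𝕊¹ → ℝ,
    ContMDiffOn (𝓡 1) 𝓘(ℝ, ℝ) ∞ L V ∧ ∀ u, circlePoint (L u) = u := by
  by_cases hu : u₀ = ptA
  · refine ⟨{ptB}ᶜ, isOpen_compl_singleton, ?_, fun u ↦ 2 * π * angB u, fun u hu' ↦ ?_,
      circlePoint_two_pi_mul_angB⟩
    · rw [mem_compl_singleton_iff, hu]; exact ptA_ne_ptB
    · exact ((contDiff_const.mul contDiff_id).contDiffAt.comp_contMDiffAt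
        (contMDiffAt_angB hu')).contMDiffWithinAt
  · refine ⟨{ptA}ᶜ, isOpen_compl_singleton, hu, fun u ↦ 2 * π * angA u, fun u hu' ↦ ?_,
      circlePoint_two_pi_mul_angA⟩
    exact ((contDiff_const.mul contDiff_id).contDiffAt.comp_contMDiffAt
      (contMDiffAt_angA hu')).contMDiffWithinAt

/-- `d(circlePoint)_θ (c) = c · d(circlePoint)_θ (1)` (linearity in the real variable).
[folklore] -/
theorem mfderiv_circlePoint_apply_real (θ c : ℝ) :
    mfderiv 𝓘(ℝ, ℝ) (𝓡 1) circlePoint θ c = c • mfderiv 𝓘(ℝ, ℝ) (𝓡 1) circlePoint θ 1 := by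
  rw [← map_smul]
  congr 1
  change c = c * 1
  rw [mul_one]

/-- The differential of `circlePoint : ℝ → 𝕊¹` is injective at every point. [folklore] -/
theorem mfderiv_circlePoint_injective (θ : ℝ) :
    Injective (mfderiv 𝓘(ℝ, ℝ) (𝓡 1) circlePoint θ) := by
  let A : ℝ →L[ℝ] TangentSpace (𝓡 1) (circlePoint θ) := mfderiv 𝓘(ℝ, ℝ) (𝓡 1) circlePoint θ
  change Injective A
  refine (injective_iff_map_eq_zero A).2 fun a ha ↦ ?_
  have h : a • A 1 = 0 := (mfderiv_circlePoint_apply_real θ a).symm.trans ha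
  rcases smul_eq_zero.1 h with h' | h'
  · exact h'
  · exact absurd h' (mfderiv_circlePoint_apply_ne_zero θ)

/-- The tangent spaces of `𝕊¹` are lines: every tangent vector is a multiple of the (nonzero)
velocity `d(circlePoint)_θ (1)`. [folklore] -/
theorem exists_smul_mfderiv_circlePoint_one (θ : ℝ) (w : TangentSpace (𝓡 1) (circlePoint θ)) :
    ∃ c : ℝ, c • mfderiv 𝓘(ℝ, ℝ) (𝓡 1) circlePoint θ 1 = w := by
  have h1 : Module.finrank ℝ (EuclideanSpace ℝ (Fin 1)) = 1 := finrank_euclideanSpace_fin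
  exact (finrank_eq_one_iff_of_nonzero' _ (mfderiv_circlePoint_apply_ne_zero θ)).1 h1 w

end CircleFacts

/-! ### Calculus: `circlePoint ∘ φ` is a submersion exactly where `dφ ≠ 0`; Fermat -/

section Calculus

variable {E : Type*} [NormedAddCommGroup E] [NormedSpace ℝ E] {H : Type*} [TopologicalSpace H]
  {IM : ModelWithCorners ℝ E H} {M : Type*} [TopologicalSpace M] [ChartedSpace H M]

/-- **Onto the line `T𝕊¹` means nonzero**: the differential of a circle-valued map at a point
is onto iff it is nonzero (`T𝕊¹` is one-dimensional). [folklore] -/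
theorem surjective_mfderiv_sphereOne_iff_ne_zero (g : M → 𝕊¹) (x : M) :
    Surjective (mfderiv IM (𝓡 1) g x) ↔ mfderiv IM (𝓡 1) g x ≠ 0 := by
  haveI : Nontrivial (TangentSpace (𝓡 1) (g x)) :=
    (inferInstance : Nontrivial (EuclideanSpace ℝ (Fin 1)))
  have h1 : Module.finrank ℝ (TangentSpace (𝓡 1) (g x)) = 1 := finrank_euclideanSpace_fin
  set T := mfderiv IM (𝓡 1) g x with hT
  constructor
  · intro hs hT0
    obtain ⟨w, hw⟩ := exists_ne (0 : TangentSpace (𝓡 1) (g x))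
    obtain ⟨v, hv⟩ := hs w
    rw [hT0] at hv
    exact hw hv.symm
  · intro hT0 w
    obtain ⟨v, hv⟩ : ∃ v, T v ≠ 0 := by
      by_contra h
      push Not at h
      exact hT0 (ContinuousLinearMap.ext h)
    obtain ⟨c, hc⟩ := (finrank_eq_one_iff_of_nonzero' (T v) hv).1 h1 w
    exact ⟨c • v, by rw [map_smul, hc]⟩

/-- **`d(circlePoint ∘ φ) ≠ 0` iff `dφ ≠ 0`** for a real function `φ` differentiable at `x`
(chain rule and injectivity of `d(circlePoint)`). [folklore] -/
theorem mfderiv_circlePoint_comp_ne_zero_iff {φ : M → ℝ} {x : M}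
    (hφ : MDifferentiableAt IM 𝓘(ℝ, ℝ) φ x) :
    mfderiv IM (𝓡 1) (circlePoint ∘ φ) x ≠ 0 ↔ mfderiv IM 𝓘(ℝ, ℝ) φ x ≠ 0 := by
  have hc : MDifferentiableAt 𝓘(ℝ, ℝ) (𝓡 1) circlePoint (φ x) :=
    contMDiff_circlePoint.mdifferentiableAt (by simp)
  rw [mfderiv_comp x hc hφ]
  constructor
  · intro h hB
    apply h
    rw [hB, ContinuousLinearMap.comp_zero]
    rfl
  · intro hB h
    apply hB
    refine ContinuousLinearMap.ext fun v ↦ ?_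
    have hv : mfderiv 𝓘(ℝ, ℝ) (𝓡 1) circlePoint (φ x) (mfderiv IM 𝓘(ℝ, ℝ) φ x v) =
        mfderiv 𝓘(ℝ, ℝ) (𝓡 1) circlePoint (φ x) 0 := by
      rw [map_zero]
      exact congrArg (fun T ↦ T v) h
    exact mfderiv_circlePoint_injective (φ x) hv

/-- **`circlePoint ∘ φ` is a submersion exactly where `dφ ≠ 0`.** [folklore] -/
theorem surjective_mfderiv_circlePoint_comp_iff {φ : M → ℝ} {x : M}
    (hφ : MDifferentiableAt IM 𝓘(ℝ, ℝ) φ x) :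
    Surjective (mfderiv IM (𝓡 1) (circlePoint ∘ φ) x) ↔ mfderiv IM 𝓘(ℝ, ℝ) φ x ≠ 0 :=
  (surjective_mfderiv_sphereOne_iff_ne_zero _ x).trans (mfderiv_circlePoint_comp_ne_zero_iff hφ)

/-- The differential of an affine change `c + r · ψ` (`r ≠ 0`) of a real function vanishes iff
that of `ψ` does. [folklore] -/
theorem mfderiv_const_add_const_mul_ne_zero_iff {ψ : M → ℝ} {x : M}
    (hψ : MDifferentiableAt IM 𝓘(ℝ, ℝ) ψ x) (c : ℝ) {r : ℝ} (hr : r ≠ 0) :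
    mfderiv IM 𝓘(ℝ, ℝ) (fun y ↦ c + r * ψ y) x ≠ 0 ↔ mfderiv IM 𝓘(ℝ, ℝ) ψ x ≠ 0 := by
  have hD : HasMFDerivAt IM 𝓘(ℝ, ℝ) ψ x (mfderiv IM 𝓘(ℝ, ℝ) ψ x) := hψ.hasMFDerivAt
  have h0 : HasMFDerivAt IM 𝓘(ℝ, ℝ) (fun _ : M ↦ c) x
      (0 : TangentSpace IM x →L[ℝ] ℝ) := hasMFDerivAt_const c x
  have h1 : HasMFDerivAt IM 𝓘(ℝ, ℝ) (fun y ↦ c + r * ψ y) x (r • mfderiv IM 𝓘(ℝ, ℝ) ψ x) := by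
    have h := h0.add (hD.const_smul r)
    rw [zero_add] at h
    exact h
  constructor
  · intro h hψ0
    have e : r • mfderiv IM 𝓘(ℝ, ℝ) ψ x = 0 := by rw [hψ0, smul_zero]
    exact h (h1.mfderiv.trans e)
  · intro h haff
    have e : r • mfderiv IM 𝓘(ℝ, ℝ) ψ x = 0 := h1.mfderiv.symm.trans haff
    exact h ((smul_eq_zero.1 e).resolve_left hr)

/-- **Fermat's theorem on a boundaryless manifold**: at a global maximum point of a real
function the differential vanishes (in the chart, Mathlib's `IsLocalMax.fderiv_eq_zero`).
[folklore] -/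
theorem mfderiv_eq_zero_of_isMaxOn_univ [IM.Boundaryless] {φ : M → ℝ} {x : M}
    (hmax : IsMaxOn φ univ x) : mfderiv IM 𝓘(ℝ, ℝ) φ x = 0 := by
  by_cases hd : MDifferentiableAt IM 𝓘(ℝ, ℝ) φ x
  · rw [hd.mfderiv, ModelWithCorners.Boundaryless.range_eq_univ, fderivWithin_univ]
    have hw : writtenInExtChartAt IM 𝓘(ℝ, ℝ) x φ = φ ∘ (extChartAt IM x).symm := by
      ext z
      simp [writtenInExtChartAt]
    rw [hw]
    apply IsLocalMax.fderiv_eq_zero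
    refine Filter.Eventually.of_forall fun z ↦ ?_
    simp only [Function.comp_apply, extChartAt_to_inv]
    exact hmax (mem_univ _)
  · exact mfderiv_zero_of_not_mdifferentiableAt hd

end Calculus

/-! ### Circle-valued maps: increments read through `toCircle` -/

section Increments

variable {P : Type*} [TopologicalSpace P]

/-- The circle-valued map `f : P → 𝕊¹` read in the circle group `Circle ⊆ ℂ` (so that the
tree's increments and winding numbers `CircleMaps.incr`, `CircleMaps.winding` apply). [folklore] -/
def circleLift (f : C(P, 𝕊¹)) : C(P, Circle) := toCircleC.comp f

/-- `circleLift f` is `toCircle ∘ f`. [folklore] -/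
@[simp] theorem circleLift_apply (f : C(P, 𝕊¹)) (x : P) : circleLift f x = toCircle (f x) := rfl

/-- `exp (incr F γ) = F(y) / F(x)` for the increment along a path from `x` to `y`. [folklore] -/
theorem exp_incr (F : C(P, Circle)) {x y : P} (γ : Path x y) :
    Circle.exp (incr F γ) = F y / F x := by
  rw [incr, Circle.exp_sub, exp_liftOf, exp_liftOf, γ.source, γ.target]

/-- `exp (arg F(x₀) + incr F γ) = F(x)` for a path `γ` from `x₀` to `x`. [folklore] -/
theorem exp_arg_add_incr (F : C(P, Circle)) {x₀ x : P} (γ : Path x₀ x) :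
    Circle.exp (Complex.arg (F x₀ : ℂ) + incr F γ) = F x := by
  rw [Circle.exp_add, exp_incr, Circle.exp_arg, mul_div_cancel]

/-- **Increments through a region carrying a continuous angle.** If `L` is continuous on `W`
and `circlePoint (L y) = f y` on `W`, the increment of `f` along a path inside `W` from `x` to
`y` is `L y - L x` (uniqueness of lifts, Hatcher 2002, Prop. 1.30).
[cite: HatcherAT2002, Prop. 1.30] -/
theorem incr_circleLift_eq_of_mem (f : C(P, 𝕊¹)) {W : Set P} {L : P → ℝ}
    (hL : ContinuousOn L W) (hlift : ∀ y ∈ W, circlePoint (L y) = f y) {x y : P} (γ : Path x y)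
    (hγ : ∀ t, γ t ∈ W) : incr (circleLift f) γ = L y - L x := by
  have hG : Continuous fun t ↦ L (γ t) :=
    hL.comp_continuous γ.continuous hγ
  rw [incr_eq_of_lift (circleLift f) γ hG fun t ↦ ?_, γ.source, γ.target]
  rw [circleLift_apply, ← toCircle_circlePoint, hlift _ (hγ t)]

/-- For a loop, `exp (incr) = 1`; more generally the increment along a path whose endpoints have
the same value is an integer multiple of `2π`. [folklore] -/
theorem exists_int_incr_eq_of_apply_eq (F : C(P, Circle)) {a b : P} (α : Path a b)
    (hab : F a = F b) : ∃ w : ℤ, incr F α = w * (2 * π) := by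
  have h : Circle.exp (incr F α) = Circle.exp 0 := by
    rw [exp_incr, hab, div_self', Circle.exp_zero]
  obtain ⟨w, hw⟩ := Circle.exp_eq_exp.1 h
  exact ⟨w, by rw [hw, zero_add]⟩

/-- Iterated loops `ℓᵏ = ℓ ⬝ ⋯ ⬝ ℓ`. [folklore] -/
def loopPow {a : P} (ℓ : Path a a) : ℕ → Path a a
  | 0 => Path.refl a
  | k + 1 => (loopPow ℓ k).trans ℓ

/-- Increments are additive along iterated loops. [folklore] -/
theorem incr_loopPow (F : C(P, Circle)) {a : P} (ℓ : Path a a) (k : ℕ) :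
    incr F (loopPow ℓ k) = k * incr F ℓ := by
  induction k with
  | zero => simp [loopPow, incr_refl]
  | succ k ih =>
      show incr F ((loopPow ℓ k).trans ℓ) = _
      rw [incr_trans, ih]; push_cast; ring

/-- **The winding numbers at a base point form the subgroup `dℤ`**: there is `d : ℕ` which is a
winding number of some loop at `x₀` and divides all of them (subgroups of `ℤ` are cyclic).
[folklore] -/
theorem exists_nat_generator_winding (F : C(P, Circle)) (x₀ : P) :
    ∃ d : ℕ, (∃ γ : Path x₀ x₀, winding F γ = d) ∧ ∀ γ : Path x₀ x₀, (d : ℤ) ∣ winding F γ := by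
  let S : AddSubgroup ℤ :=
    { carrier := {m | ∃ γ : Path x₀ x₀, winding F γ = m}
      zero_mem' := ⟨Path.refl x₀, winding_refl F x₀⟩
      add_mem' := by
        rintro _ _ ⟨γ, rfl⟩ ⟨γ', rfl⟩
        exact ⟨γ.trans γ', winding_trans F γ γ'⟩
      neg_mem' := by
        rintro _ ⟨γ, rfl⟩
        exact ⟨γ.symm, winding_symm F γ⟩ }
  obtain ⟨a, ha⟩ := Int.subgroup_cyclic S
  have hmem : a ∈ S := by rw [ha]; exact AddSubgroup.subset_closure (mem_singleton a)
  have hmem' : ∃ γ : Path x₀ x₀, winding F γ = a := hmem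
  obtain ⟨γa, hγa⟩ := hmem'
  refine ⟨a.natAbs, ?_, fun γ ↦ ?_⟩
  · rcases Int.natAbs_eq a with h | h
    · exact ⟨γa, by rw [hγa]; exact h⟩
    · exact ⟨γa.symm, by rw [winding_symm, hγa]; linarith⟩
  · have hγ : winding F γ ∈ S := ⟨γ, rfl⟩
    rw [ha, AddSubgroup.mem_closure_singleton] at hγ
    obtain ⟨k, hk⟩ := hγ
    rw [Int.natAbs_dvd]
    exact ⟨k, by rw [← hk, smul_eq_mul, mul_comm]⟩

/-- If `d ≠ 0` divides every winding number at `x₀`, then `(1/d) · incr F γ ∈ 2πℤ` for every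
loop `γ` at `x₀`. [folklore] -/
theorem exists_int_inv_mul_incr_eq (F : C(P, Circle)) {x₀ : P} {d : ℕ} (hd : d ≠ 0)
    (hdiv : ∀ γ : Path x₀ x₀, (d : ℤ) ∣ winding F γ) (γ : Path x₀ x₀) :
    ∃ k : ℤ, (1 / (d : ℝ)) * incr F γ = k * (2 * π) := by
  obtain ⟨k, hk⟩ := hdiv γ
  refine ⟨k, ?_⟩
  have hd' : (d : ℝ) ≠ 0 := by exact_mod_cast hd
  rw [incr_eq_winding, hk]
  push_cast
  field_simp

end Increments

/-! ### The `d`-th root of a circle-valued map (Hatcher's lifting construction) -/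

section Root

variable {P : Type*} [TopologicalSpace P] [PathConnectedSpace P]

/-- **The modified circle-valued map** `g_r(x) = (cos, sin)(r · (arg F(x₀) + incr F γₓ))`, `γₓ`
some path from `x₀` to `x` (for `r = 1/d` this is a `d`-th root of `f`, for `r = 1` it is `f`
itself; the construction "`f̃(y) = f̃γ(1)`" of the proof of the lifting criterion).
[cite: HatcherAT2002, Prop. 1.33 (proof)] -/
def rootMap (f : C(P, 𝕊¹)) (x₀ : P) (r : ℝ) (x : P) : 𝕊¹ :=
  circlePoint (r * (Complex.arg (circleLift f x₀ : ℂ) + incr (circleLift f)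
    (PathConnectedSpace.somePath x₀ x)))

variable (f : C(P, 𝕊¹)) (x₀ : P) {r : ℝ}

/-- **Independence of the path** (well-definedness in Hatcher's Prop. 1.33): if
`r · incr F γ ∈ 2πℤ` for all loops `γ` at `x₀`, then `g_r(x)` may be computed with ANY path from
`x₀` to `x`. [cite: HatcherAT2002, Prop. 1.33 (proof)] -/
theorem rootMap_eq_of_path (hr : ∀ γ : Path x₀ x₀, ∃ k : ℤ, r * incr (circleLift f) γ = k * (2 * π))
    {x : P} (γ : Path x₀ x) :
    rootMap f x₀ r x = circlePoint (r * (Complex.arg (circleLift f x₀ : ℂ) + incr (circleLift f) γ)) := by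
  set γ₀ := PathConnectedSpace.somePath x₀ x
  obtain ⟨k, hk⟩ := hr (γ₀.trans γ.symm)
  rw [incr_trans, incr_symm] at hk
  have h : r * (Complex.arg (circleLift f x₀ : ℂ) + incr (circleLift f) γ₀) =
      r * (Complex.arg (circleLift f x₀ : ℂ) + incr (circleLift f) γ) + k * (2 * π) := by
    linear_combination hk
  rw [rootMap, h]
  exact periodic_circlePoint.int_mul k _

/-- With all winding numbers at `x₀` equal to zero, the real function
`Λ(x) = arg F(x₀) + incr F γₓ` does not depend on the path at all. [folklore] -/
theorem arg_add_incr_somePath_eq (h0 : ∀ γ : Path x₀ x₀, incr (circleLift f) γ = 0) {x : P}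
    (γ : Path x₀ x) :
    Complex.arg (circleLift f x₀ : ℂ) + incr (circleLift f) (PathConnectedSpace.somePath x₀ x) =
      Complex.arg (circleLift f x₀ : ℂ) + incr (circleLift f) γ := by
  have hk := h0 ((PathConnectedSpace.somePath x₀ x).trans γ.symm)
  rw [incr_trans, incr_symm] at hk
  linarith

/-- `g_r(x)ᵈ = F(x)` in `Circle` when `r = 1/d`. [folklore] -/
theorem toCircle_rootMap_pow {d : ℕ} (hd : d ≠ 0)
    (hr : ∀ γ : Path x₀ x₀, ∃ k : ℤ, (1 / (d : ℝ)) * incr (circleLift f) γ = k * (2 * π)) (x : P) :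
    toCircle (rootMap f x₀ (1 / (d : ℝ)) x) ^ d = toCircle (f x) := by
  have hd' : (d : ℝ) ≠ 0 := by exact_mod_cast hd
  rw [rootMap_eq_of_path f x₀ hr (PathConnectedSpace.somePath x₀ x), toCircle_circlePoint,
    ← zpow_natCast, circleExp_zpow, Int.cast_natCast, ← mul_assoc, mul_one_div_cancel hd',
    one_mul, exp_arg_add_incr, circleLift_apply]

/-- **Local form of the root map.** Under the integrality hypothesis, every point `x` has a
neighbourhood on which `g_r = circlePoint ∘ (c + r · (L ∘ f))` for a constant `c` and a global
right inverse `L` of `circlePoint` that is smooth on an open set containing `f` of the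
neighbourhood (lift along paths inside the region where the local angle is continuous).
[cite: HatcherAT2002, Prop. 1.33 (proof, continuity of the lift)] -/
theorem exists_nhds_rootMap_eq [LocallyPathConnectedSpace P]
    (hr : ∀ γ : Path x₀ x₀, ∃ k : ℤ, r * incr (circleLift f) γ = k * (2 * π)) (x : P) :
    ∃ U ∈ 𝓝 x, ∃ V : Set 𝕊¹, IsOpen V ∧ (∀ y ∈ U, f y ∈ V) ∧ ∃ L : 𝕊¹ → ℝ,
      ContMDiffOn (𝓡 1) 𝓘(ℝ, ℝ) ∞ L V ∧ (∀ u, circlePoint (L u) = u) ∧ ∃ c : ℝ,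
        ∀ y ∈ U, rootMap f x₀ r y = circlePoint (c + r * L (f y)) := by
  obtain ⟨V, hV, hxV, L, hL, hLid⟩ := exists_isOpen_angle (f x)
  set W : Set P := f ⁻¹' V with hW
  have hWx : W ∈ 𝓝 x := (hV.preimage f.continuous).mem_nhds hxV
  refine ⟨pathComponentIn W x, pathComponentIn_mem_nhds hWx, V, hV,
    fun y hy ↦ mem_preimage.1 (pathComponentIn_subset hy), L, hL, hLid,
    r * (Complex.arg (circleLift f x₀ : ℂ) + incr (circleLift f) (PathConnectedSpace.somePath x₀ x))
      - r * L (f x), fun y hy ↦ ?_⟩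
  -- a path from `x` to `y` inside `W`, along which `L ∘ f` is a continuous angle
  obtain ⟨τ, hτ⟩ : ∃ τ : Path x y, ∀ t, τ t ∈ W := ⟨hy.somePath, hy.somePath_mem⟩
  have hLW : ContinuousOn (L ∘ f) W :=
    hL.continuousOn.comp f.continuous.continuousOn (mapsTo_preimage f V)
  have hincr : incr (circleLift f) τ = L (f y) - L (f x) :=
    incr_circleLift_eq_of_mem f hLW (fun z _ ↦ hLid (f z)) τ hτ
  rw [rootMap_eq_of_path f x₀ hr ((PathConnectedSpace.somePath x₀ x).trans τ), incr_trans, hincr]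
  congr 1
  ring

/-- The root map is continuous (for continuous `f`). [folklore] -/
theorem continuous_rootMap [LocallyPathConnectedSpace P]
    (hr : ∀ γ : Path x₀ x₀, ∃ k : ℤ, r * incr (circleLift f) γ = k * (2 * π)) :
    Continuous (rootMap f x₀ r) := by
  refine continuous_iff_continuousAt.2 fun x ↦ ?_
  obtain ⟨U, hU, V, hV, hUV, L, hL, -, c, hc⟩ := exists_nhds_rootMap_eq f x₀ hr x
  have hx : x ∈ U := mem_of_mem_nhds hU
  have hcont : ContinuousAt (fun y ↦ circlePoint (c + r * L (f y))) x := by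
    refine continuous_circlePoint.continuousAt.comp (continuousAt_const.add
      (continuousAt_const.mul ?_))
    exact (hL.continuousOn.continuousAt (hV.mem_nhds (hUV x hx))).comp f.continuous.continuousAt
  refine hcont.congr_of_eventuallyEq ?_
  filter_upwards [hU] with y hy using hc y hy

end Root

/-! ### Smoothness and the differential of the root map -/

section SmoothRoot

variable {n : ℕ} {P : Type*} [TopologicalSpace P] [ChartedSpace (EuclideanSpace ℝ (Fin n)) P]
  [PathConnectedSpace P]

variable (f : C(P, 𝕊¹)) (x₀ : P) {r : ℝ}

/-- **The root map of a smooth map is smooth** (locally `circlePoint ∘ (c + r · L ∘ f)` with `L`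
a smooth local angle). [folklore] -/
theorem contMDiff_rootMap (hf : ContMDiff (𝓡 n) (𝓡 1) ∞ f)
    (hr : ∀ γ : Path x₀ x₀, ∃ k : ℤ, r * incr (circleLift f) γ = k * (2 * π)) :
    ContMDiff (𝓡 n) (𝓡 1) ∞ (rootMap f x₀ r) := by
  haveI := ChartedSpace.locallyPathConnectedSpace (EuclideanSpace ℝ (Fin n)) P
  intro x
  obtain ⟨U, hU, V, hV, hUV, L, hL, -, c, hc⟩ := exists_nhds_rootMap_eq f x₀ hr x
  have hx : x ∈ U := mem_of_mem_nhds hU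
  have hLf : ContMDiffAt (𝓡 n) 𝓘(ℝ, ℝ) ∞ (L ∘ f) x :=
    (hL.contMDiffAt (hV.mem_nhds (hUV x hx))).comp x (hf x)
  have hφ : ContMDiffAt (𝓡 n) 𝓘(ℝ, ℝ) ∞ (fun y ↦ c + r * L (f y)) x :=
    (contDiff_const.add (contDiff_const.mul contDiff_id)).contDiffAt.comp_contMDiffAt hLf
  have hg : ContMDiffAt (𝓡 n) (𝓡 1) ∞ (fun y ↦ circlePoint (c + r * L (f y))) x :=
    contMDiff_circlePoint.contMDiffAt.comp x hφ
  refine hg.congr_of_eventuallyEq ?_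
  filter_upwards [hU] with y hy using hc y hy

/-- **The root map is a submersion exactly where `f` is** (`r ≠ 0`): near `x`,
`f = circlePoint ∘ (L ∘ f)` and `g_r = circlePoint ∘ (c + r · L ∘ f)`, and `circlePoint ∘ φ` is
submersive iff `dφ ≠ 0`. [folklore] -/
theorem surjective_mfderiv_rootMap_iff (hf : ContMDiff (𝓡 n) (𝓡 1) ∞ f)
    (hr : ∀ γ : Path x₀ x₀, ∃ k : ℤ, r * incr (circleLift f) γ = k * (2 * π)) (hr0 : r ≠ 0)
    (x : P) :
    Surjective (mfderiv (𝓡 n) (𝓡 1) (rootMap f x₀ r) x) ↔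
      Surjective (mfderiv (𝓡 n) (𝓡 1) f x) := by
  haveI := ChartedSpace.locallyPathConnectedSpace (EuclideanSpace ℝ (Fin n)) P
  obtain ⟨U, hU, V, hV, hUV, L, hL, hLid, c, hc⟩ := exists_nhds_rootMap_eq f x₀ hr x
  have hx : x ∈ U := mem_of_mem_nhds hU
  have hLf : ContMDiffAt (𝓡 n) 𝓘(ℝ, ℝ) ∞ (L ∘ f) x :=
    (hL.contMDiffAt (hV.mem_nhds (hUV x hx))).comp x (hf x)
  have hLf' : MDifferentiableAt (𝓡 n) 𝓘(ℝ, ℝ) (L ∘ f) x := hLf.mdifferentiableAt (by simp)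
  have hφ : ContMDiffAt (𝓡 n) 𝓘(ℝ, ℝ) ∞ (fun y ↦ c + r * (L ∘ f) y) x :=
    (contDiff_const.add (contDiff_const.mul contDiff_id)).contDiffAt.comp_contMDiffAt hLf
  have hφ' : MDifferentiableAt (𝓡 n) 𝓘(ℝ, ℝ) (fun y ↦ c + r * (L ∘ f) y) x :=
    hφ.mdifferentiableAt (by simp)
  -- `f = circlePoint ∘ (L ∘ f)` globally, `g_r = circlePoint ∘ (c + r · L ∘ f)` near `x`
  have hfeq : (f : P → 𝕊¹) = circlePoint ∘ (L ∘ f) := funext fun y ↦ (hLid (f y)).symm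
  have hgeq : rootMap f x₀ r =ᶠ[𝓝 x] (circlePoint ∘ fun y ↦ c + r * (L ∘ f) y) := by
    filter_upwards [hU] with y hy using hc y hy
  have e1 : mfderiv (𝓡 n) (𝓡 1) (rootMap f x₀ r) x =
      mfderiv (𝓡 n) (𝓡 1) (circlePoint ∘ fun y ↦ c + r * (L ∘ f) y) x := hgeq.mfderiv_eq
  have e2 := congrArg (fun g : P → 𝕊¹ ↦
    @id (TangentSpace (𝓡 n) x →L[ℝ] EuclideanSpace ℝ (Fin 1)) (mfderiv (𝓡 n) (𝓡 1) g x)) hfeq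
  rw [surjective_mfderiv_sphereOne_iff_ne_zero, surjective_mfderiv_sphereOne_iff_ne_zero]
  calc mfderiv (𝓡 n) (𝓡 1) (rootMap f x₀ r) x ≠ 0
      ↔ mfderiv (𝓡 n) (𝓡 1) (circlePoint ∘ fun y ↦ c + r * (L ∘ f) y) x ≠ 0 :=
        ⟨fun h h0 ↦ h (e1.trans h0), fun h h0 ↦ h (e1.symm.trans h0)⟩
    _ ↔ mfderiv (𝓡 n) 𝓘(ℝ, ℝ) (fun y ↦ c + r * (L ∘ f) y) x ≠ 0 :=
        mfderiv_circlePoint_comp_ne_zero_iff hφ'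
    _ ↔ mfderiv (𝓡 n) 𝓘(ℝ, ℝ) (L ∘ f) x ≠ 0 :=
        mfderiv_const_add_const_mul_ne_zero_iff hLf' c hr0
    _ ↔ mfderiv (𝓡 n) (𝓡 1) (circlePoint ∘ (L ∘ f)) x ≠ 0 :=
        (mfderiv_circlePoint_comp_ne_zero_iff hLf').symm
    _ ↔ mfderiv (𝓡 n) (𝓡 1) f x ≠ 0 :=
        ⟨fun h h0 ↦ h (e2.symm.trans h0), fun h h0 ↦ h (e2.trans h0)⟩

/-- **A submersion of a compact manifold onto the circle has a loop with nonzero winding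
number.** Otherwise `arg F(x₀) + incr F γₓ` is a continuous, hence smooth, real lift `Λ` of `f`;
at a maximum point of `Λ` on the compact `P`, `dΛ = 0`, so `df` is not onto there.
[folklore] -/
theorem exists_winding_ne_zero [CompactSpace P] (hf : ContMDiff (𝓡 n) (𝓡 1) ∞ f)
    (hsub : ∀ x, Surjective (mfderiv (𝓡 n) (𝓡 1) f x)) :
    ∃ γ : Path x₀ x₀, winding (circleLift f) γ ≠ 0 := by
  haveI := ChartedSpace.locallyPathConnectedSpace (EuclideanSpace ℝ (Fin n)) P
  by_contra hall
  push Not at hall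
  have h0 : ∀ γ : Path x₀ x₀, incr (circleLift f) γ = 0 := fun γ ↦ by
    rw [incr_eq_winding, hall γ]; simp
  -- the global lift
  set Λ : P → ℝ := fun x ↦ Complex.arg (circleLift f x₀ : ℂ) +
    incr (circleLift f) (PathConnectedSpace.somePath x₀ x) with hΛ
  have hfΛ : (f : P → 𝕊¹) = circlePoint ∘ Λ := by
    funext x
    exact (circlePoint_eq_of_exp_eq (exp_arg_add_incr (circleLift f) _)).symm
  -- `Λ` is smooth: locally `Λ = c + L ∘ f`
  have hΛs : ContMDiff (𝓡 n) 𝓘(ℝ, ℝ) ∞ Λ := by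
    intro x
    obtain ⟨V, hV, hxV, L, hL, hLid⟩ := exists_isOpen_angle (f x)
    set W : Set P := f ⁻¹' V with hW
    have hWx : W ∈ 𝓝 x := (hV.preimage f.continuous).mem_nhds hxV
    have hLW : ContinuousOn (L ∘ f) W :=
      hL.continuousOn.comp f.continuous.continuousOn (mapsTo_preimage f V)
    have hloc : ∀ y ∈ pathComponentIn W x, Λ y = (Λ x - L (f x)) + L (f y) := by
      intro y hy
      obtain ⟨τ, hτ⟩ : ∃ τ : Path x y, ∀ t, τ t ∈ W := ⟨hy.somePath, hy.somePath_mem⟩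
      have hincr : incr (circleLift f) τ = L (f y) - L (f x) :=
        incr_circleLift_eq_of_mem f hLW (fun z _ ↦ hLid (f z)) τ hτ
      have h1 := arg_add_incr_somePath_eq f x₀ h0 ((PathConnectedSpace.somePath x₀ x).trans τ)
      rw [incr_trans, hincr] at h1
      simp only [hΛ]
      rw [h1]
      ring
    have hLf : ContMDiffAt (𝓡 n) 𝓘(ℝ, ℝ) ∞ (L ∘ f) x :=
      (hL.contMDiffAt (hV.mem_nhds hxV)).comp x (hf x)
    have hφ : ContMDiffAt (𝓡 n) 𝓘(ℝ, ℝ) ∞ (fun y ↦ (Λ x - L (f x)) + L (f y)) x :=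
      (contDiff_const.add contDiff_id).contDiffAt.comp_contMDiffAt hLf
    refine hφ.congr_of_eventuallyEq ?_
    filter_upwards [pathComponentIn_mem_nhds hWx] with y hy using hloc y hy
  -- a maximum point of `Λ`
  haveI : Nonempty P := ⟨x₀⟩
  obtain ⟨xM, -, hxM⟩ :=
    isCompact_univ.exists_isMaxOn univ_nonempty hΛs.continuous.continuousOn
  have hd0 : mfderiv (𝓡 n) 𝓘(ℝ, ℝ) Λ xM = 0 := mfderiv_eq_zero_of_isMaxOn_univ hxM
  have hsurj := hsub xM
  rw [hfΛ, surjective_mfderiv_circlePoint_comp_iff ((hΛs xM).mdifferentiableAt (by simp))] at hsurj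
  exact hsurj hd0

end SmoothRoot

/-! ### From a locally trivial fibration to a fibre bundle with a fixed fibre -/

section FixedFibre

variable {E : Type*} {B : Type*} [TopologicalSpace E] [TopologicalSpace B] {p : E → B}

/-- Over a trivialising neighbourhood `U` of `b`, every fibre `p⁻¹(b')`, `b' ∈ U`, is
homeomorphic to `p⁻¹(b)`. [folklore] -/
theorem nonempty_fibre_homeomorph_of_trivialisation {b : B} {U : Set B}
    (φ : ↥U × ↥(p ⁻¹' {b}) ≃ₜ ↥(p ⁻¹' U)) (hφ : ∀ x : ↥U × ↥(p ⁻¹' {b}), p (φ x) = x.1)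
    {b' : B} (hb' : b' ∈ U) : Nonempty (↥(p ⁻¹' {b'}) ≃ₜ ↥(p ⁻¹' {b})) := by
  -- membership facts
  have hmem : ∀ z : ↥(p ⁻¹' {b'}), (z : E) ∈ p ⁻¹' U := fun z ↦ by
    have hz : p z = b' := z.2
    show p z ∈ U
    rw [hz]; exact hb'
  have hfst : ∀ z : ↥(p ⁻¹' {b'}), (φ.symm ⟨z, hmem z⟩).1 = ⟨b', hb'⟩ := fun z ↦ by
    apply Subtype.ext
    have h := hφ (φ.symm ⟨z, hmem z⟩)
    rw [Homeomorph.apply_symm_apply] at h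
    have hz : p z = b' := z.2
    exact h.symm.trans hz
  have hinv : ∀ w : ↥(p ⁻¹' {b}), ((φ (⟨b', hb'⟩, w) : ↥(p ⁻¹' U)) : E) ∈ p ⁻¹' {b'} := fun w ↦ by
    show p _ ∈ ({b'} : Set B)
    rw [hφ]
    exact mem_singleton b'
  refine ⟨{ toFun := fun z ↦ (φ.symm ⟨z, hmem z⟩).2
            invFun := fun w ↦ ⟨(φ (⟨b', hb'⟩, w) : ↥(p ⁻¹' U)), hinv w⟩
            left_inv := fun z ↦ ?_
            right_inv := fun w ↦ ?_
            continuous_toFun := ?_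
            continuous_invFun := ?_ }⟩
  · apply Subtype.ext
    have hpair : ((⟨b', hb'⟩ : ↥U), (φ.symm ⟨z, hmem z⟩).2) = φ.symm ⟨z, hmem z⟩ :=
      Prod.ext (hfst z).symm rfl
    show ((φ (⟨b', hb'⟩, (φ.symm ⟨z, hmem z⟩).2) : ↥(p ⁻¹' U)) : E) = z
    rw [hpair, Homeomorph.apply_symm_apply]
  · have hι : (⟨((φ (⟨b', hb'⟩, w) : ↥(p ⁻¹' U)) : E), hmem ⟨_, hinv w⟩⟩ : ↥(p ⁻¹' U)) =
        φ (⟨b', hb'⟩, w) := Subtype.ext rfl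
    show (φ.symm ⟨((φ (⟨b', hb'⟩, w) : ↥(p ⁻¹' U)) : E), hmem ⟨_, hinv w⟩⟩).2 = w
    rw [hι, Homeomorph.symm_apply_apply]
  · exact (continuous_snd.comp φ.symm.continuous).comp (continuous_subtype_val.subtype_mk _)
  · exact (continuous_subtype_val.comp
      (φ.continuous.comp (continuous_const.prodMk continuous_id))).subtype_mk _

/-- **A locally trivial fibration over a (pre)connected base is a fibre bundle with fibre any
one of its fibres**: the set of base points whose fibre is homeomorphic to `p⁻¹(b₀)` is open and
closed (fibres are locally pairwise homeomorphic), and composing the local trivialisations with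
these homeomorphisms gives charts with the fixed fibre `p⁻¹(b₀)`. (Bröcker–Jänich state
Ehresmann's theorem with the fibre `f⁻¹(p)`; Hatcher's bundles have a fixed fibre.) [folklore] -/
theorem isFibreBundleWith_of_isLocallyTrivialFibration [PreconnectedSpace B] (hp : Continuous p)
    (h : IsLocallyTrivialFibration p) (b₀ : B) : IsFibreBundleWith (↥(p ⁻¹' {b₀})) p := by
  set T : Set B := {b | Nonempty (↥(p ⁻¹' {b}) ≃ₜ ↥(p ⁻¹' {b₀}))} with hT
  have hTopen : IsOpen T := by
    refine isOpen_iff_mem_nhds.2 fun b hb ↦ ?_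
    obtain ⟨e⟩ := hb
    obtain ⟨U, hU, hbU, φ, hφ⟩ := h b
    refine mem_of_superset (hU.mem_nhds hbU) fun b' hb' ↦ ?_
    obtain ⟨e'⟩ := nonempty_fibre_homeomorph_of_trivialisation φ hφ hb'
    exact ⟨e'.trans e⟩
  have hTclosed : IsClosed T := by
    rw [← isOpen_compl_iff]
    refine isOpen_iff_mem_nhds.2 fun b hb ↦ ?_
    obtain ⟨U, hU, hbU, φ, hφ⟩ := h b
    refine mem_of_superset (hU.mem_nhds hbU) fun b' hb' hbT ↦ hb ?_
    obtain ⟨e⟩ := hbT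
    obtain ⟨e'⟩ := nonempty_fibre_homeomorph_of_trivialisation φ hφ hb'
    exact ⟨e'.symm.trans e⟩
  have hTuniv : T = univ := IsClopen.eq_univ ⟨hTclosed, hTopen⟩ ⟨b₀, ⟨Homeomorph.refl _⟩⟩
  refine ⟨hp, fun b ↦ ?_⟩
  obtain ⟨U, hU, hbU, φ, hφ⟩ := h b
  obtain ⟨e⟩ : b ∈ T := by rw [hTuniv]; exact mem_univ b
  refine ⟨U, hU, hbU, φ.symm.trans ((Homeomorph.refl ↥U).prodCongr e), fun z ↦ ?_⟩
  have h1 := hφ (φ.symm z)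
  rw [Homeomorph.apply_symm_apply] at h1
  exact h1.symm

end FixedFibre

/-! ### Connected fibres from a loop of winding number one -/

section ConnectedFibres

open unitInterval

variable {P : Type*} [TopologicalSpace P] [PathConnectedSpace P]

/-- **Correcting a path by loops of winding number one.** If some loop has `g`-winding number
`1`, any two points `a`, `b` with `g a = g b` are joined by a path `β` with `incr g β = 0`
(subtract the right power of a winding-one loop at `a`). [folklore] -/
theorem exists_path_incr_eq_zero (g : C(P, 𝕊¹)) {x₀ : P} (γ₁ : Path x₀ x₀)
    (h1 : winding (circleLift g) γ₁ = 1) {a b : P} (hab : g a = g b) :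
    ∃ β : Path a b, incr (circleLift g) β = 0 := by
  set G := circleLift g with hG
  let α : Path a b := PathConnectedSpace.somePath a b
  obtain ⟨w, hw⟩ := exists_int_incr_eq_of_apply_eq G α (by simp [hG, hab])
  -- a loop at `a` of winding number one
  let δ : Path a x₀ := PathConnectedSpace.somePath a x₀
  have hw1 : winding G (δ.trans (γ₁.trans δ.symm)) = 1 := by rw [winding_conj, h1]
  have hℓ : incr G (δ.trans (γ₁.trans δ.symm)) = 2 * π := by
    rw [incr_eq_winding, hw1]; simp
  set ℓ : Path a a := δ.trans (γ₁.trans δ.symm) with hℓdef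
  obtain ⟨k, rfl | rfl⟩ := Int.eq_nat_or_neg w
  · refine ⟨(loopPow ℓ.symm k).trans α, ?_⟩
    rw [incr_trans, incr_loopPow, incr_symm, hℓ, hw]
    push_cast
    ring
  · refine ⟨(loopPow ℓ k).trans α, ?_⟩
    rw [incr_trans, incr_loopPow, hℓ, hw]
    push_cast
    ring

/-- **Fibres are path connected when some loop has winding number one** (the segment
`π₁(P) → π₁(𝕊¹) → π₀(fibre) → π₀(P)` of the homotopy sequence of the bundle, Hatcher 2002,
Thm. 4.41 with Prop. 4.48, made explicit): for a fibre bundle `g : P → 𝕊¹` over the circle with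
path-connected total space and a loop of `g`-winding number `1`, two points of a fibre are joined
inside the fibre. Take a path `β` between them with `incr g β = 0`; `g ∘ β` lifts to a loop in
`ℝ`, which is null-homotopic rel endpoints; lift the null-homotopy relative to
`{0} × I ∪ I × ∂I` (`IsFibreBundleWith.exists_homotopy_lift_rel`) and read off its far end.
[cite: HatcherAT2002, Thm. 4.41 and Prop. 4.48] -/
theorem joinedIn_fibre_of_winding_eq_one {Fib : Type*} [TopologicalSpace Fib] (g : C(P, 𝕊¹))
    (hb : IsFibreBundleWith Fib g) {x₀ : P} (γ₁ : Path x₀ x₀)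
    (h1 : winding (circleLift g) γ₁ = 1) {θ : 𝕊¹} {a b : P} (ha : g a = θ) (hbθ : g b = θ) :
    JoinedIn (g ⁻¹' {θ}) a b := by
  set G := circleLift g with hG
  obtain ⟨β, hβ⟩ := exists_path_incr_eq_zero g γ₁ h1 (ha.trans hbθ.symm)
  -- the real lift of `g ∘ β` is a loop
  set Λ : C(I, ℝ) := liftOf G β with hΛ
  have hΛlift : ∀ t, circlePoint (Λ t) = g (β t) := fun t ↦
    circlePoint_eq_of_exp_eq (by rw [hΛ, exp_liftOf]; rfl)
  have h10 : Λ 1 = Λ 0 := by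
    have : Λ 1 - Λ 0 = 0 := hβ
    linarith
  let Λp : Path (Λ 0) (Λ 0) := ⟨Λ, rfl, h10⟩
  -- null-homotopy of the loop `Λ` in `ℝ`, pushed to the circle
  let cp : C(ℝ, 𝕊¹) := ⟨circlePoint, continuous_circlePoint⟩
  have hhom : (Λp.map cp.continuous).Homotopic ((Path.refl (Λ 0)).map cp.continuous) :=
    (SimplyConnectedSpace.paths_homotopic Λp (Path.refl (Λ 0))).map cp
  obtain ⟨Hh⟩ := hhom
  have hH0 : ∀ s : I, Hh (0, s) = g (β s) := fun s ↦ by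
    rw [Hh.apply_zero]; exact hΛlift s
  have hH1 : ∀ s : I, Hh (1, s) = g a := fun s ↦ by
    rw [Hh.apply_one]
    show circlePoint (Λ 0) = g a
    rw [hΛlift 0, β.source]
  have hHs : ∀ t : I, Hh (t, 0) = g a := fun t ↦ by
    rw [Hh.source]
    show circlePoint (Λ 0) = g a
    rw [hΛlift 0, β.source]
  have hHt : ∀ t : I, Hh (t, 1) = g a := fun t ↦ by
    rw [Hh.target]
    show circlePoint (Λ 0) = g a
    rw [hΛlift 0, β.source]
  -- the homotopy as a map on `I × I¹`, and the partial lift `β` on `{0} × I¹ ∪ I × ∂I¹`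
  let K : C(I × (Fin 1 → I), 𝕊¹) :=
    ⟨fun z ↦ Hh (z.1, z.2 0), (map_continuous Hh).comp (continuous_fst.prodMk
      ((continuous_apply 0).comp continuous_snd))⟩
  let gp : I × (Fin 1 → I) → P := fun z ↦ β (z.2 0)
  have hgp : Continuous gp := β.continuous.comp ((continuous_apply 0).comp continuous_snd)
  have hlift : ∀ z ∈ (({0} : Set I) ×ˢ univ ∪ univ ×ˢ Cube.boundary (Fin 1) :
      Set (I × (Fin 1 → I))), g (gp z) = K z := by
    rintro ⟨t, y⟩ hz
    show g (β (y 0)) = Hh (t, y 0)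
    rcases hz with ⟨ht, -⟩ | ⟨-, i, hi⟩
    · have ht0 : t = 0 := ht
      rw [ht0, hH0]
    · have hi0 : i = 0 := Subsingleton.elim i 0
      rw [hi0] at hi
      rcases hi with h | h
      · change y 0 = 0 at h
        rw [h, hHs, β.source]
      · change y 0 = 1 at h
        rw [h, hHt, β.target, ha, hbθ]
  obtain ⟨Gl, hGl, hGlA⟩ := hb.exists_homotopy_lift_rel K gp hgp.continuousOn hlift
  -- the far end of the lifted homotopy is a path in the fibre from `a` to `b`
  have hmem0 : ((1 : I), (fun _ : Fin 1 ↦ (0 : I))) ∈ (({0} : Set I) ×ˢ univ ∪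
      univ ×ˢ Cube.boundary (Fin 1) : Set (I × (Fin 1 → I))) :=
    Or.inr ⟨mem_univ _, 0, Or.inl rfl⟩
  have hmem1 : ((1 : I), (fun _ : Fin 1 ↦ (1 : I))) ∈ (({0} : Set I) ×ˢ univ ∪
      univ ×ˢ Cube.boundary (Fin 1) : Set (I × (Fin 1 → I))) :=
    Or.inr ⟨mem_univ _, 0, Or.inr rfl⟩
  refine ⟨{ toFun := fun s ↦ Gl (1, fun _ ↦ s)
            continuous_toFun := Gl.continuous.comp (continuous_const.prodMk
              (continuous_pi fun _ ↦ continuous_id))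
            source' := by
              show Gl (1, fun _ ↦ 0) = a
              rw [hGlA _ hmem0]
              show β 0 = a
              exact β.source
            target' := by
              show Gl (1, fun _ ↦ 1) = b
              rw [hGlA _ hmem1]
              show β 1 = b
              exact β.target }, fun s ↦ ?_⟩
  show g (Gl (1, fun _ ↦ s)) ∈ ({θ} : Set 𝕊¹)
  rw [hGl, mem_singleton_iff]
  show Hh (1, s) = θ
  rw [hH1, ha]

/-- Under the same hypotheses every fibre is path connected (it is nonempty because all fibres
of a bundle over a connected base are homeomorphic and one of them contains `x₀`). [folklore] -/
theorem isPathConnected_fibre_of_winding_eq_one (g : C(P, 𝕊¹)) {x₀ : P}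
    (hb : IsFibreBundleWith (↥(g ⁻¹' {g x₀})) g) (γ₁ : Path x₀ x₀)
    (h1 : winding (circleLift g) γ₁ = 1) (θ : 𝕊¹) : IsPathConnected (g ⁻¹' {θ}) := by
  obtain ⟨e⟩ := hb.nonempty_fibre_homeomorph θ
  let a : ↥(g ⁻¹' {θ}) := e.symm ⟨x₀, by simp⟩
  refine ⟨a, a.2, fun b hb' ↦ ?_⟩
  exact joinedIn_fibre_of_winding_eq_one g hb γ₁ h1 a.2 hb'

end ConnectedFibres

/-! ### The theorem -/

section Main

variable {n : ℕ} {P : Type u} [TopologicalSpace P] [T2Space P] [SecondCountableTopology P]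
  [ChartedSpace (EuclideanSpace ℝ (Fin n)) P] [IsManifold (𝓡 n) ∞ P] [CompactSpace P]
  [ConnectedSpace P]

/-- **A closed manifold that submerses onto the circle fibres over it with connected fibres.**
For a `C^∞` submersion `f : P → 𝕊¹` of a compact connected manifold there are `d ≥ 1` and a
`C^∞` submersion `g : P → 𝕊¹` with `g(x)ᵈ = f(x)` in `Circle ⊆ ℂ` all of whose fibres are path
connected (Stein factorisation over the circle: `g` is the composite of `f`'s monodromy-corrected
`d`-th root; Hatcher 2002, Prop. 1.33 for the root, Ehresmann (Bröcker–Jänich (8.12)) and the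
homotopy sequence Thm. 4.41/Prop. 4.48 for the fibres). [folklore] -/
theorem exists_contMDiff_surjective_mfderiv_isPathConnected_fibre {f : P → 𝕊¹}
    (hf : ContMDiff (𝓡 n) (𝓡 1) ∞ f) (hsub : ∀ x, Surjective (mfderiv (𝓡 n) (𝓡 1) f x)) :
    ∃ (d : ℕ) (g : P → 𝕊¹), 0 < d ∧ ContMDiff (𝓡 n) (𝓡 1) ∞ g ∧
      (∀ x, Surjective (mfderiv (𝓡 n) (𝓡 1) g x)) ∧ (∀ x, toCircle (g x) ^ d = toCircle (f x)) ∧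
      ∀ θ, IsPathConnected (g ⁻¹' {θ}) := by
  haveI := ChartedSpace.locallyPathConnectedSpace (EuclideanSpace ℝ (Fin n)) P
  haveI : PathConnectedSpace P := pathConnectedSpace_iff_connectedSpace.2 inferInstance
  let x₀ : P := Classical.arbitrary P
  let fC : C(P, 𝕊¹) := ⟨f, hf.continuous⟩
  have hfC : ContMDiff (𝓡 n) (𝓡 1) ∞ fC := hf
  obtain ⟨d, ⟨γ₁, hγ₁⟩, hdiv⟩ := exists_nat_generator_winding (circleLift fC) x₀
  -- `d ≠ 0`
  have hd : d ≠ 0 := by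
    rintro rfl
    obtain ⟨γ, hγ⟩ := exists_winding_ne_zero fC x₀ hfC hsub
    exact hγ (zero_dvd_iff.1 (by exact_mod_cast hdiv γ))
  have hd' : (d : ℝ) ≠ 0 := by exact_mod_cast hd
  have hr := exists_int_inv_mul_incr_eq (circleLift fC) hd hdiv
  set g : P → 𝕊¹ := rootMap fC x₀ (1 / (d : ℝ)) with hgdef
  have hgs : ContMDiff (𝓡 n) (𝓡 1) ∞ g := contMDiff_rootMap fC x₀ hfC hr
  have hgsub : ∀ x, Surjective (mfderiv (𝓡 n) (𝓡 1) g x) := fun x ↦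
    (surjective_mfderiv_rootMap_iff fC x₀ hfC hr (one_div_ne_zero hd') x).2 (hsub x)
  have hpow : ∀ x, toCircle (g x) ^ d = toCircle (f x) := fun x ↦
    toCircle_rootMap_pow fC x₀ hd hr x
  -- a loop of `g`-winding number one
  let gC : C(P, 𝕊¹) := ⟨g, hgs.continuous⟩
  have hGpow : circleLift gC ^ (d : ℤ) = circleLift fC := by
    refine ContinuousMap.ext fun x ↦ ?_
    rw [ContinuousMap.zpow_apply]
    show toCircle (g x) ^ (d : ℤ) = toCircle (f x)
    rw [zpow_natCast, hpow]
  have h1 : winding (circleLift gC) γ₁ = 1 := by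
    have h := winding_zpow (circleLift gC) γ₁ d
    rw [hGpow, hγ₁] at h
    exact (Int.eq_one_of_mul_eq_self_right (by exact_mod_cast hd) h.symm)
  -- Ehresmann: `g` is a fibre bundle with a fixed fibre
  have hproper : IsProperMap g := hgs.continuous.isProperMap
  have hltf : IsLocallyTrivialFibration g :=
    ehresmann_fibration_holds n 1 P (𝕊¹) g hgs hproper hgsub
  haveI : PathConnectedSpace (𝕊¹) := by
    refine isPathConnected_iff_pathConnectedSpace.mp (isPathConnected_sphere ?_ _ zero_le_one)
    rw [← Module.finrank_eq_rank, finrank_euclideanSpace_fin]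
    norm_num
  have hb : IsFibreBundleWith (↥(g ⁻¹' {g x₀})) g :=
    isFibreBundleWith_of_isLocallyTrivialFibration hgs.continuous hltf (g x₀)
  exact ⟨d, g, Nat.pos_of_ne_zero hd, hgs, hgsub, hpow, fun θ ↦
    isPathConnected_fibre_of_winding_eq_one gC hb γ₁ h1 θ⟩

/-- **Corollary (the normal form used for fibrations over the circle).** A compact connected
manifold admitting a smooth submersion onto `𝕊¹` admits one all of whose fibres are connected.
[folklore] -/
theorem exists_contMDiff_surjective_mfderiv_isConnected_fibre {f : P → 𝕊¹}
    (hf : ContMDiff (𝓡 n) (𝓡 1) ∞ f) (hsub : ∀ x, Surjective (mfderiv (𝓡 n) (𝓡 1) f x)) :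
    ∃ g : P → 𝕊¹, ContMDiff (𝓡 n) (𝓡 1) ∞ g ∧ (∀ x, Surjective (mfderiv (𝓡 n) (𝓡 1) g x)) ∧
      ∀ θ, IsConnected (g ⁻¹' {θ}) := by
  obtain ⟨-, g, -, hg, hgsub, -, hconn⟩ :=
    exists_contMDiff_surjective_mfderiv_isPathConnected_fibre hf hsub
  exact ⟨g, hg, hgsub, fun θ ↦ (hconn θ).isConnected⟩

end Main

end Literature.Geometry.Manifold
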